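import Literature.Topology.FourManifolds.LatticeFormsSpecialOrthogonalEichlerGeneration
import HarnessLib

/-!
# The commutator subgroup of `O(U ⊕ U ⊕ U)`: `[O, O] = [O⁺, O⁺] = [SO⁺, SO⁺] = SO⁺(3U)`,
# `O⁺(3U)^{ab} ≅ ℤ/2ℤ` and `O(3U)^{ab} ≅ (ℤ/2ℤ)²` with explicit coset representatives
# (Gritsenko–Hulek–Sankaran, *J. Algebra* 322 (2009) Thm. 1.7, Cor. 1.8 — the case `L = 3U`)

Trunk T-4MAN vocabulary. Sequel of `LatticeFormsSpecialOrthogonalEichlerGeneration.lean` (row g49-#7: `SO⁺(3U) = E(3U)` is a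
word in commutators of admissible words; `O⁺(3U) = SO⁺ ∪ SO⁺·σ`), `LatticeFormsStableSpecialOrthogonalWords.lean` (induction
on words; `det`, `O⁺` pass to words) and `LatticeFormsTwoHyperbolicPlanesSpecialOrthogonal.lean` (`det` and `O⁺` for `σ_H`,
`−1_H`, `−σ_H`). Written for lane `lit-hodgefound` (Track 2 foundations; prover seat `lit-hodgefound-p18`, gen 49, row g49-#9).
THEOREMS ONLY — no definition, no named fact, no instance, no notation.

## Source, verbatim (held text `paper:arxiv-0810.1614`, p. 4)

"**Theorem 1.7** Let `L` be an even integral lattice containing at least two hyperbolic planes, such that `rank₂(L) ≥ 6`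
and `rank₃(L) ≥ 5`. Then `S̃O⁺(L)^{ab}` is trivial and `Õ⁺(L)^{ab} ≅ ℤ/2ℤ`." "**Corollary 1.8** For `L` a lattice as in
Theorem 1.7, the orthogonal group `Õ⁺(L)` has only one non-trivial character, namely `det`, and `S̃O⁺(L)` has no non-trivial
characters." and, for `L_{2d}`: "`[O(L_{2d}), O(L_{2d})] = S̃O⁺(L_{2d})` and `O(L_{2d})^{ab} ≅ (ℤ/2ℤ)^{ρ(d)+2}`."

## Contents (all proved) and reading notes

`L = U ⊕ U ⊕ U` realised as `(H ⊕ H) ⊕ H` is even, unimodular (`Õ = O`, `S̃O⁺ = SO⁺`), of `rank₂ = rank₃ = 6`, so Theorem 1.7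
applies to it; row g49-#7 proved its conclusion for this lattice from the Eichler transvections alone. Here the group theory is
spelled out with the commutator `[α,β] = αβα⁻¹β⁻¹ = ((β⁻¹·α⁻¹)·β)·α` (`IsometryEquiv.trans` composes left to right).

* §1 (any symmetric non-degenerate lattice) `det [α,β] = 1`, `[α,β] ∈ O⁺`; hence **every word in commutators lies in `SO⁺(L)`**
  (`IsWordIn.isOrientationPreserving_and_det_eq_one_of_commutators`) — `det` and the real spinor norm are characters.
* §2 **`SO⁺(3U)` is perfect** (`isWordIn_commutators_of_specialOrthogonal_iff_threeU`: the words in commutators of elements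
  of `SO⁺(3U)` are exactly `SO⁺(3U)`), **`[O⁺(3U), O⁺(3U)] = SO⁺(3U)`** (`isWordIn_commutators_of_isOrientationPreserving_iff_threeU`)
  and **`[O(3U), O(3U)] = SO⁺(3U)`** (`isWordIn_commutators_iff_threeU`) — Theorem 1.7 (i) and the display of p. 4 for `3U`.
* §3 **`O⁺(3U)^{ab} ≅ ℤ/2ℤ`**: with `σ = 1 ⊕ 1 ⊕ σ_H` (`σ_H` the swap of the outer plane, a `(−2)`-reflection, `det σ = −1`,
  `σ ∈ O⁺`): `φσ ∈ [O⁺,O⁺] ⟺ φ ∈ O⁺ ∧ det φ = −1`, so for `φ ∈ O⁺(3U)` exactly one of `φ`, `φσ` is a word in commutators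
  (`xor_isWordIn_commutators_trans_swap_of_isOrientationPreserving_threeU`) — Theorem 1.7 (ii) for `3U`.
* §4 **`O(3U)^{ab} ≅ (ℤ/2ℤ)²`**: the four cosets of `[O,O] = SO⁺` are cut out by `(χ, det) ∈ {±1}²` with representatives
  `1`, `1 ⊕ 1 ⊕ σ_H` (`χ = 1`, `det = −1`), `1 ⊕ 1 ⊕ (−1_H)` (`χ = −1`, `det = 1`), `1 ⊕ 1 ⊕ (−σ_H)` (`χ = det = −1`)
  (`isWordIn_commutators_trans_swap_iff_threeU`, `…_trans_neg_iff_threeU`, `…_trans_swap_trans_neg_iff_threeU`,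
  `isWordIn_commutators_or_or_or_threeU`) — the `3U` analogue of "`O(L_{2d})^{ab} ≅ (ℤ/2ℤ)^{ρ(d)+2}`" (`O(q_{3U}) = 1`).
-/

noncomputable section

open Module
open LinearMap (BilinForm)
open LinearMap.BilinForm
open LinearMap.BilinForm (IsometryEquiv)
open Literature.LinearAlgebra.QuadraticForm

namespace Literature.Topology.FourManifolds

/-! ### §1 Commutators lie in `SO⁺(L)` -/

section Commutators

universe u

variable {L : Type u} [AddCommGroup L] {Q : BilinForm ℤ L}

/-- `det (γσ) = det σ · det γ` (plumbing). [cite: GritsenkoHulekSankaran2009, Cor. 1.8 ("det" is a character)] -/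
theorem IsometryEquiv.det_trans_eq_mul (γ σ : Q.IsometryEquiv Q) :
    LinearMap.det ((γ.trans σ : Q.IsometryEquiv Q) : L →ₗ[ℤ] L) =
      LinearMap.det (σ : L →ₗ[ℤ] L) * LinearMap.det (γ : L →ₗ[ℤ] L) := by
  rw [show ((γ.trans σ : Q.IsometryEquiv Q) : L →ₗ[ℤ] L) = (σ : L →ₗ[ℤ] L) ∘ₗ (γ : L →ₗ[ℤ] L) from
    LinearMap.ext fun _ ↦ rfl, LinearMap.det_comp]

/-- `det γ⁻¹ · det γ = 1` (plumbing). [cite: GritsenkoHulekSankaran2009, Cor. 1.8 ("det" is a character)] -/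
theorem IsometryEquiv.det_symm_mul_det_eq_one (γ : Q.IsometryEquiv Q) :
    LinearMap.det ((γ.symm : Q.IsometryEquiv Q) : L →ₗ[ℤ] L) * LinearMap.det (γ : L →ₗ[ℤ] L) = 1 := by
  rw [← LinearMap.det_comp, show ((γ.symm : Q.IsometryEquiv Q) : L →ₗ[ℤ] L) ∘ₗ (γ : L →ₗ[ℤ] L) = LinearMap.id from
    LinearMap.ext fun x ↦ γ.toLinearEquiv.symm_apply_apply x, LinearMap.det_id]

/-- **`det [α,β] = 1`** for the commutator `[α,β] = αβα⁻¹β⁻¹` of two isometries of a lattice.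
[cite: GritsenkoHulekSankaran2009, Cor. 1.8 ("det" is a character of Õ⁺(L))] -/
theorem IsometryEquiv.det_commutator (α β : Q.IsometryEquiv Q) :
    LinearMap.det ((((β.symm.trans α.symm).trans β).trans α : Q.IsometryEquiv Q) : L →ₗ[ℤ] L) = 1 := by
  rw [IsometryEquiv.det_trans_eq_mul, IsometryEquiv.det_trans_eq_mul, IsometryEquiv.det_trans_eq_mul]
  have ha := IsometryEquiv.det_symm_mul_det_eq_one α
  have hb := IsometryEquiv.det_symm_mul_det_eq_one β
  calc LinearMap.det (α : L →ₗ[ℤ] L) * (LinearMap.det (β : L →ₗ[ℤ] L) *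
        (LinearMap.det ((α.symm : Q.IsometryEquiv Q) : L →ₗ[ℤ] L) *
          LinearMap.det ((β.symm : Q.IsometryEquiv Q) : L →ₗ[ℤ] L)))
      = (LinearMap.det ((α.symm : Q.IsometryEquiv Q) : L →ₗ[ℤ] L) * LinearMap.det (α : L →ₗ[ℤ] L)) *
          (LinearMap.det ((β.symm : Q.IsometryEquiv Q) : L →ₗ[ℤ] L) * LinearMap.det (β : L →ₗ[ℤ] L)) := by ring
    _ = 1 := by rw [ha, hb, one_mul]

variable [Module.Finite ℤ L] [Module.Free ℤ L]

/-- **`[α,β] ∈ O⁺(L)`** (`Q` symmetric non-degenerate): the orientation character (real spinor norm) is a homomorphism to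
`{±1}`, so it kills commutators. [cite: GritsenkoHulekSankaran2009, §1 ("O⁺(L) = O(L) ∩ ker sn_ℝ") and Cor. 1.8] -/
theorem IsometryEquiv.isOrientationPreserving_commutator (hQ : Q.IsSymm) (hnd : Q.Nondegenerate)
    (α β : Q.IsometryEquiv Q) : (((β.symm.trans α.symm).trans β).trans α : Q.IsometryEquiv Q).IsOrientationPreserving := by
  rw [LinearMap.BilinForm.IsometryEquiv.isOrientationPreserving_trans_iff hQ hnd,
    LinearMap.BilinForm.IsometryEquiv.isOrientationPreserving_trans_iff hQ hnd,
    LinearMap.BilinForm.IsometryEquiv.isOrientationPreserving_trans_iff hQ hnd,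
    LinearMap.BilinForm.IsometryEquiv.isOrientationPreserving_symm_iff hQ hnd,
    LinearMap.BilinForm.IsometryEquiv.isOrientationPreserving_symm_iff hQ hnd]
  generalize α.IsOrientationPreserving = a
  generalize β.IsOrientationPreserving = b
  tauto

/-- **`[O(L), O(L)] ⊆ SO⁺(L)`**: every word in commutators of isometries of a symmetric non-degenerate lattice preserves
the orientation of the positive directions and has determinant `1` (`det` and `sn_ℝ` are characters).
[cite: GritsenkoHulekSankaran2009, Cor. 1.8 and p. 4 ("[O(L_{2d}), O(L_{2d})] = S̃O⁺(L_{2d})")] -/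
theorem IsWordIn.isOrientationPreserving_and_det_eq_one_of_commutators (hQ : Q.IsSymm) (hnd : Q.Nondegenerate)
    {S : Set (Q.IsometryEquiv Q)}
    (hS : ∀ s ∈ S, ∃ α β : Q.IsometryEquiv Q, s = ((β.symm.trans α.symm).trans β).trans α)
    {φ : Q.IsometryEquiv Q} (hφ : IsWordIn S φ) :
    φ.IsOrientationPreserving ∧ LinearMap.det (φ : L →ₗ[ℤ] L) = 1 :=
  ⟨hφ.isOrientationPreserving hQ hnd fun s hs ↦ by
      obtain ⟨α, β, rfl⟩ := hS s hs
      exact IsometryEquiv.isOrientationPreserving_commutator hQ hnd α β,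
    hφ.det_eq_one fun s hs ↦ by
      obtain ⟨α, β, rfl⟩ := hS s hs
      exact IsometryEquiv.det_commutator α β⟩

end Commutators

/-! ### §2 `[SO⁺, SO⁺] = [O⁺, O⁺] = [O, O] = SO⁺` for `L = U ⊕ U ⊕ U` -/

section ThreeU

/-- **Theorem 1.7 (i) for `L = 3U`: `SO⁺(U ⊕ U ⊕ U)` is perfect** — an isometry of `(H ⊕ H) ⊕ H` is a word in the
commutators `[α,β]`, `α, β ∈ SO⁺(3U)`, iff it lies in `SO⁺(3U)` ("`S̃O⁺(L)^{ab}` is trivial"; "⟸" is row g49-#7, the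
admissible words lying in `SO⁺`; "⟹" is §1). [cite: GritsenkoHulekSankaran2009, Thm. 1.7 and Cor. 1.8] -/
theorem isWordIn_commutators_of_specialOrthogonal_iff_threeU
    (φ : ((hyperbolicForm.prod hyperbolicForm).prod hyperbolicForm).IsometryEquiv
      ((hyperbolicForm.prod hyperbolicForm).prod hyperbolicForm)) :
    IsWordIn {ψ | ∃ α β : ((hyperbolicForm.prod hyperbolicForm).prod hyperbolicForm).IsometryEquiv
        ((hyperbolicForm.prod hyperbolicForm).prod hyperbolicForm),
        (α.IsOrientationPreserving ∧ LinearMap.det (α : ((Fin 2 → ℤ) × (Fin 2 → ℤ)) × (Fin 2 → ℤ) →ₗ[ℤ]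
          ((Fin 2 → ℤ) × (Fin 2 → ℤ)) × (Fin 2 → ℤ)) = 1) ∧
        (β.IsOrientationPreserving ∧ LinearMap.det (β : ((Fin 2 → ℤ) × (Fin 2 → ℤ)) × (Fin 2 → ℤ) →ₗ[ℤ]
          ((Fin 2 → ℤ) × (Fin 2 → ℤ)) × (Fin 2 → ℤ)) = 1) ∧
        ψ = ((β.symm.trans α.symm).trans β).trans α} φ ↔
      φ.IsOrientationPreserving ∧ LinearMap.det (φ : ((Fin 2 → ℤ) × (Fin 2 → ℤ)) × (Fin 2 → ℤ) →ₗ[ℤ]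
        ((Fin 2 → ℤ) × (Fin 2 → ℤ)) × (Fin 2 → ℤ)) = 1 := by
  have hB : ((hyperbolicForm.prod hyperbolicForm).prod hyperbolicForm).IsSymm :=
    (isSymm_hyperbolicForm.prod isSymm_hyperbolicForm).prod isSymm_hyperbolicForm
  refine ⟨fun hφ ↦ IsWordIn.isOrientationPreserving_and_det_eq_one_of_commutators hB nondegenerate_threeU
    (fun s hs ↦ by obtain ⟨α, β, -, -, hs⟩ := hs; exact ⟨α, β, hs⟩) hφ, fun h ↦ ?_⟩
  refine isWordIn_commutators_of_isOrientationPreserving_of_det_eq_one_threeU (fun l₁ l₂ hl₁ hl₂ ↦ ?_) φ h.1 h.2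
  exact ⟨_, _, (UGen.evalEquiv_mem_stableSpecialOrthogonal hB nondegenerate_threeU prod_prod_hyperbolic_hypX_hypX
      prod_prod_hyperbolic_hypY_hypY l₁ hl₁).2,
    (UGen.evalEquiv_mem_stableSpecialOrthogonal hB nondegenerate_threeU prod_prod_hyperbolic_hypX_hypX
      prod_prod_hyperbolic_hypY_hypY l₂ hl₂).2, rfl⟩

/-- **`[O⁺(3U), O⁺(3U)] = SO⁺(3U)`**: an isometry of `(H ⊕ H) ⊕ H` is a word in the commutators `[α,β]`, `α, β ∈ O⁺(3U)`,
iff it lies in `SO⁺(3U)` (so `O⁺(3U)^{ab} = O⁺/SO⁺`, of order `2` by §3). [cite: GritsenkoHulekSankaran2009, Thm. 1.7 and Cor. 1.8] -/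
theorem isWordIn_commutators_of_isOrientationPreserving_iff_threeU
    (φ : ((hyperbolicForm.prod hyperbolicForm).prod hyperbolicForm).IsometryEquiv
      ((hyperbolicForm.prod hyperbolicForm).prod hyperbolicForm)) :
    IsWordIn {ψ | ∃ α β : ((hyperbolicForm.prod hyperbolicForm).prod hyperbolicForm).IsometryEquiv
        ((hyperbolicForm.prod hyperbolicForm).prod hyperbolicForm),
        α.IsOrientationPreserving ∧ β.IsOrientationPreserving ∧ ψ = ((β.symm.trans α.symm).trans β).trans α} φ ↔
      φ.IsOrientationPreserving ∧ LinearMap.det (φ : ((Fin 2 → ℤ) × (Fin 2 → ℤ)) × (Fin 2 → ℤ) →ₗ[ℤ]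
        ((Fin 2 → ℤ) × (Fin 2 → ℤ)) × (Fin 2 → ℤ)) = 1 := by
  have hB : ((hyperbolicForm.prod hyperbolicForm).prod hyperbolicForm).IsSymm :=
    (isSymm_hyperbolicForm.prod isSymm_hyperbolicForm).prod isSymm_hyperbolicForm
  refine ⟨fun hφ ↦ IsWordIn.isOrientationPreserving_and_det_eq_one_of_commutators hB nondegenerate_threeU
    (fun s hs ↦ by obtain ⟨α, β, -, -, hs⟩ := hs; exact ⟨α, β, hs⟩) hφ, fun h ↦ ?_⟩
  refine isWordIn_commutators_of_isOrientationPreserving_of_det_eq_one_threeU (fun l₁ l₂ hl₁ hl₂ ↦ ?_) φ h.1 h.2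
  exact ⟨_, _, (UGen.evalEquiv_mem_stableSpecialOrthogonal hB nondegenerate_threeU prod_prod_hyperbolic_hypX_hypX
      prod_prod_hyperbolic_hypY_hypY l₁ hl₁).2.1,
    (UGen.evalEquiv_mem_stableSpecialOrthogonal hB nondegenerate_threeU prod_prod_hyperbolic_hypX_hypX
      prod_prod_hyperbolic_hypY_hypY l₂ hl₂).2.1, rfl⟩

/-- **`[O(3U), O(3U)] = SO⁺(3U)`**: an isometry of `(H ⊕ H) ⊕ H` is a word in commutators iff it lies in `SO⁺(3U)` — the
`3U` case of "`[O(L_{2d}), O(L_{2d})] = S̃O⁺(L_{2d})`". [cite: GritsenkoHulekSankaran2009, Thm. 1.7, Cor. 1.8 and p. 4] -/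
theorem isWordIn_commutators_iff_threeU
    (φ : ((hyperbolicForm.prod hyperbolicForm).prod hyperbolicForm).IsometryEquiv
      ((hyperbolicForm.prod hyperbolicForm).prod hyperbolicForm)) :
    IsWordIn {ψ | ∃ α β : ((hyperbolicForm.prod hyperbolicForm).prod hyperbolicForm).IsometryEquiv
        ((hyperbolicForm.prod hyperbolicForm).prod hyperbolicForm), ψ = ((β.symm.trans α.symm).trans β).trans α} φ ↔
      φ.IsOrientationPreserving ∧ LinearMap.det (φ : ((Fin 2 → ℤ) × (Fin 2 → ℤ)) × (Fin 2 → ℤ) →ₗ[ℤ]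
        ((Fin 2 → ℤ) × (Fin 2 → ℤ)) × (Fin 2 → ℤ)) = 1 := by
  have hB : ((hyperbolicForm.prod hyperbolicForm).prod hyperbolicForm).IsSymm :=
    (isSymm_hyperbolicForm.prod isSymm_hyperbolicForm).prod isSymm_hyperbolicForm
  exact ⟨fun hφ ↦ IsWordIn.isOrientationPreserving_and_det_eq_one_of_commutators hB nondegenerate_threeU
    (fun s hs ↦ hs) hφ, fun h ↦ isWordIn_commutators_of_isOrientationPreserving_of_det_eq_one_threeU
      (fun l₁ l₂ hl₁ hl₂ ↦ by exact ⟨_, _, rfl⟩) φ h.1 h.2⟩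

/-! ### §3 `O⁺(3U)^{ab} ≅ ℤ/2ℤ` -/

/-- The characters of `φ·(1 ⊕ 1 ⊕ g)` for `g ∈ O(H)` acting on the outer plane: `χ(φ(1⊕g)) = χ(g)χ(φ)`,
`det(φ(1⊕g)) = det g · det φ`. [cite: GritsenkoHulekSankaran2009, §4 ("Õ⁺(L) = ⟨S̃O⁺(L), σ_{e−f}⟩")] -/
theorem isOrientationPreserving_and_det_trans_refl_prodCongr_threeU
    (φ : ((hyperbolicForm.prod hyperbolicForm).prod hyperbolicForm).IsometryEquiv
      ((hyperbolicForm.prod hyperbolicForm).prod hyperbolicForm)) (g : hyperbolicForm.IsometryEquiv hyperbolicForm) :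
    ((φ.trans (LinearMap.BilinForm.IsometryEquiv.prodCongr
        (LinearMap.BilinForm.IsometryEquiv.refl (hyperbolicForm.prod hyperbolicForm)) g)).IsOrientationPreserving ↔
      (g.IsOrientationPreserving ↔ φ.IsOrientationPreserving)) ∧
    LinearMap.det ((φ.trans (LinearMap.BilinForm.IsometryEquiv.prodCongr
        (LinearMap.BilinForm.IsometryEquiv.refl (hyperbolicForm.prod hyperbolicForm)) g) :
        ((hyperbolicForm.prod hyperbolicForm).prod hyperbolicForm).IsometryEquiv _) :
        ((Fin 2 → ℤ) × (Fin 2 → ℤ)) × (Fin 2 → ℤ) →ₗ[ℤ] ((Fin 2 → ℤ) × (Fin 2 → ℤ)) × (Fin 2 → ℤ)) =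
      LinearMap.det (g : (Fin 2 → ℤ) →ₗ[ℤ] (Fin 2 → ℤ)) *
        LinearMap.det (φ : ((Fin 2 → ℤ) × (Fin 2 → ℤ)) × (Fin 2 → ℤ) →ₗ[ℤ] ((Fin 2 → ℤ) × (Fin 2 → ℤ)) × (Fin 2 → ℤ)) := by
  have hQ : (hyperbolicForm.prod hyperbolicForm).IsSymm := isSymm_hyperbolicForm.prod isSymm_hyperbolicForm
  have hB : ((hyperbolicForm.prod hyperbolicForm).prod hyperbolicForm).IsSymm := hQ.prod isSymm_hyperbolicForm
  refine ⟨?_, ?_⟩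
  · rw [LinearMap.BilinForm.IsometryEquiv.isOrientationPreserving_trans_iff hB nondegenerate_threeU,
      LinearMap.BilinForm.IsometryEquiv.isOrientationPreserving_refl_prodCongr_iff hQ
        nondegenerate_hyperbolicForm_prod_hyperbolicForm isSymm_hyperbolicForm isUnimodular_hyperbolicForm_holds.nondegenerate]
  · rw [IsometryEquiv.det_trans_eq_mul, IsometryEquiv.det_refl_prodCongr]

/-- **`φσ ∈ [O⁺(3U), O⁺(3U)] ⟺ φ ∈ O⁺(3U) ∧ det φ = −1`** for the swap `σ = 1 ⊕ 1 ⊕ σ_H` of the outer plane (`σ ∈ O⁺`,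
`det σ = −1`): the non-trivial coset of `SO⁺(3U)` in `O⁺(3U)`. [cite: GritsenkoHulekSankaran2009, Thm. 1.7 ("Õ⁺(L)^{ab} ≅ ℤ/2ℤ") and §4 ("Õ⁺(L) = ⟨S̃O⁺(L), σ_{e−f}⟩")] -/
theorem isWordIn_commutators_of_isOrientationPreserving_trans_swap_iff_threeU
    (φ : ((hyperbolicForm.prod hyperbolicForm).prod hyperbolicForm).IsometryEquiv
      ((hyperbolicForm.prod hyperbolicForm).prod hyperbolicForm)) :
    IsWordIn {ψ | ∃ α β : ((hyperbolicForm.prod hyperbolicForm).prod hyperbolicForm).IsometryEquiv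
        ((hyperbolicForm.prod hyperbolicForm).prod hyperbolicForm),
        α.IsOrientationPreserving ∧ β.IsOrientationPreserving ∧ ψ = ((β.symm.trans α.symm).trans β).trans α}
      (φ.trans (LinearMap.BilinForm.IsometryEquiv.prodCongr
        (LinearMap.BilinForm.IsometryEquiv.refl (hyperbolicForm.prod hyperbolicForm)) hyperbolicSwap)) ↔
      φ.IsOrientationPreserving ∧ LinearMap.det (φ : ((Fin 2 → ℤ) × (Fin 2 → ℤ)) × (Fin 2 → ℤ) →ₗ[ℤ]
        ((Fin 2 → ℤ) × (Fin 2 → ℤ)) × (Fin 2 → ℤ)) = -1 := by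
  obtain ⟨hP, hd⟩ := isOrientationPreserving_and_det_trans_refl_prodCongr_threeU φ hyperbolicSwap
  rw [isWordIn_commutators_of_isOrientationPreserving_iff_threeU, hP, hd, det_hyperbolicSwap]
  constructor
  · rintro ⟨h₁, h₂⟩
    exact ⟨h₁.1 isOrientationPreserving_hyperbolicSwap, by linarith⟩
  · rintro ⟨h₁, h₂⟩
    exact ⟨iff_of_true isOrientationPreserving_hyperbolicSwap h₁, by rw [h₂]; norm_num⟩

/-- **Theorem 1.7 (ii) for `L = 3U`: `O⁺(U ⊕ U ⊕ U)^{ab} ≅ ℤ/2ℤ`** — for `φ ∈ O⁺(3U)` exactly one of `φ`, `φσ` is a word in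
commutators of elements of `O⁺(3U)` (`σ = 1 ⊕ 1 ⊕ σ_H`): `O⁺(3U) = SO⁺(3U) ⊔ SO⁺(3U)·σ` with `SO⁺(3U) = [O⁺, O⁺]`.
[cite: GritsenkoHulekSankaran2009, Thm. 1.7 and §4 ("Õ⁺(L) = ⟨S̃O⁺(L), σ_{e−f}⟩")] -/
theorem xor_isWordIn_commutators_trans_swap_of_isOrientationPreserving_threeU
    (φ : ((hyperbolicForm.prod hyperbolicForm).prod hyperbolicForm).IsometryEquiv
      ((hyperbolicForm.prod hyperbolicForm).prod hyperbolicForm)) (h₁ : φ.IsOrientationPreserving) :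
    Xor (IsWordIn {ψ | ∃ α β : ((hyperbolicForm.prod hyperbolicForm).prod hyperbolicForm).IsometryEquiv
        ((hyperbolicForm.prod hyperbolicForm).prod hyperbolicForm),
        α.IsOrientationPreserving ∧ β.IsOrientationPreserving ∧ ψ = ((β.symm.trans α.symm).trans β).trans α} φ)
      (IsWordIn {ψ | ∃ α β : ((hyperbolicForm.prod hyperbolicForm).prod hyperbolicForm).IsometryEquiv
        ((hyperbolicForm.prod hyperbolicForm).prod hyperbolicForm),
        α.IsOrientationPreserving ∧ β.IsOrientationPreserving ∧ ψ = ((β.symm.trans α.symm).trans β).trans α}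
        (φ.trans (LinearMap.BilinForm.IsometryEquiv.prodCongr
          (LinearMap.BilinForm.IsometryEquiv.refl (hyperbolicForm.prod hyperbolicForm)) hyperbolicSwap))) := by
  rw [isWordIn_commutators_of_isOrientationPreserving_iff_threeU,
    isWordIn_commutators_of_isOrientationPreserving_trans_swap_iff_threeU]
  rcases LinearMap.BilinForm.IsometryEquiv.det_eq_one_or_eq_neg_one φ with hd | hd
  · exact Or.inl ⟨⟨h₁, hd⟩, fun h ↦ by rw [hd] at h; norm_num at h⟩
  · exact Or.inr ⟨⟨h₁, hd⟩, fun h ↦ by rw [hd] at h; norm_num at h⟩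

/-! ### §4 `O(3U)^{ab} ≅ (ℤ/2ℤ)²`: the four cosets of `[O(3U), O(3U)] = SO⁺(3U)` -/

/-- **The coset `SO⁺·σ`**: `φ·(1 ⊕ 1 ⊕ σ_H)` is a word in commutators iff `φ ∈ O⁺(3U)` and `det φ = −1`.
[cite: GritsenkoHulekSankaran2009, Thm. 1.7, Cor. 1.8 and p. 4 ("O(L_{2d})^{ab} ≅ (ℤ/2ℤ)^{ρ(d)+2}")] -/
theorem isWordIn_commutators_trans_swap_iff_threeU
    (φ : ((hyperbolicForm.prod hyperbolicForm).prod hyperbolicForm).IsometryEquiv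
      ((hyperbolicForm.prod hyperbolicForm).prod hyperbolicForm)) :
    IsWordIn {ψ | ∃ α β : ((hyperbolicForm.prod hyperbolicForm).prod hyperbolicForm).IsometryEquiv
        ((hyperbolicForm.prod hyperbolicForm).prod hyperbolicForm), ψ = ((β.symm.trans α.symm).trans β).trans α}
      (φ.trans (LinearMap.BilinForm.IsometryEquiv.prodCongr
        (LinearMap.BilinForm.IsometryEquiv.refl (hyperbolicForm.prod hyperbolicForm)) hyperbolicSwap)) ↔
      φ.IsOrientationPreserving ∧ LinearMap.det (φ : ((Fin 2 → ℤ) × (Fin 2 → ℤ)) × (Fin 2 → ℤ) →ₗ[ℤ]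
        ((Fin 2 → ℤ) × (Fin 2 → ℤ)) × (Fin 2 → ℤ)) = -1 := by
  obtain ⟨hP, hd⟩ := isOrientationPreserving_and_det_trans_refl_prodCongr_threeU φ hyperbolicSwap
  rw [isWordIn_commutators_iff_threeU, hP, hd, det_hyperbolicSwap]
  constructor
  · rintro ⟨h₁, h₂⟩
    exact ⟨h₁.1 isOrientationPreserving_hyperbolicSwap, by linarith⟩
  · rintro ⟨h₁, h₂⟩
    exact ⟨iff_of_true isOrientationPreserving_hyperbolicSwap h₁, by rw [h₂]; norm_num⟩

/-- **The coset `SO⁺·(1 ⊕ 1 ⊕ (−1_H))`**: `φ·(1 ⊕ 1 ⊕ (−1_H))` is a word in commutators iff `φ ∉ O⁺(3U)` and `det φ = 1`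
(`−1_H ∉ O⁺(H)`, `det(−1_H) = 1`). [cite: GritsenkoHulekSankaran2009, Thm. 1.7, Cor. 1.8 and p. 4 ("O(L_{2d})^{ab} ≅ (ℤ/2ℤ)^{ρ(d)+2}")] -/
theorem isWordIn_commutators_trans_neg_iff_threeU
    (φ : ((hyperbolicForm.prod hyperbolicForm).prod hyperbolicForm).IsometryEquiv
      ((hyperbolicForm.prod hyperbolicForm).prod hyperbolicForm)) :
    IsWordIn {ψ | ∃ α β : ((hyperbolicForm.prod hyperbolicForm).prod hyperbolicForm).IsometryEquiv
        ((hyperbolicForm.prod hyperbolicForm).prod hyperbolicForm), ψ = ((β.symm.trans α.symm).trans β).trans α}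
      (φ.trans (LinearMap.BilinForm.IsometryEquiv.prodCongr
        (LinearMap.BilinForm.IsometryEquiv.refl (hyperbolicForm.prod hyperbolicForm))
        (LinearMap.BilinForm.IsometryEquiv.neg hyperbolicForm))) ↔
      ¬ φ.IsOrientationPreserving ∧ LinearMap.det (φ : ((Fin 2 → ℤ) × (Fin 2 → ℤ)) × (Fin 2 → ℤ) →ₗ[ℤ]
        ((Fin 2 → ℤ) × (Fin 2 → ℤ)) × (Fin 2 → ℤ)) = 1 := by
  obtain ⟨hP, hd⟩ := isOrientationPreserving_and_det_trans_refl_prodCongr_threeU φ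
    (LinearMap.BilinForm.IsometryEquiv.neg hyperbolicForm)
  rw [isWordIn_commutators_iff_threeU, hP, hd, det_neg_hyperbolicForm, one_mul]
  have hn := not_isOrientationPreserving_neg_hyperbolicForm
  constructor
  · rintro ⟨h₁, h₂⟩
    exact ⟨fun h ↦ hn (h₁.2 h), h₂⟩
  · rintro ⟨h₁, h₂⟩
    exact ⟨iff_of_false hn h₁, h₂⟩

/-- **The coset `SO⁺·(1 ⊕ 1 ⊕ (−σ_H))`**: `φ·(1 ⊕ 1 ⊕ σ_H(−1_H))` is a word in commutators iff `φ ∉ O⁺(3U)` and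
`det φ = −1` (`−σ_H = σ_{e+f} ∉ O⁺(H)`, `det = −1`). [cite: GritsenkoHulekSankaran2009, Thm. 1.7, Cor. 1.8 and p. 4 ("O(L_{2d})^{ab} ≅ (ℤ/2ℤ)^{ρ(d)+2}")] -/
theorem isWordIn_commutators_trans_swap_trans_neg_iff_threeU
    (φ : ((hyperbolicForm.prod hyperbolicForm).prod hyperbolicForm).IsometryEquiv
      ((hyperbolicForm.prod hyperbolicForm).prod hyperbolicForm)) :
    IsWordIn {ψ | ∃ α β : ((hyperbolicForm.prod hyperbolicForm).prod hyperbolicForm).IsometryEquiv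
        ((hyperbolicForm.prod hyperbolicForm).prod hyperbolicForm), ψ = ((β.symm.trans α.symm).trans β).trans α}
      (φ.trans (LinearMap.BilinForm.IsometryEquiv.prodCongr
        (LinearMap.BilinForm.IsometryEquiv.refl (hyperbolicForm.prod hyperbolicForm))
        (hyperbolicSwap.trans (LinearMap.BilinForm.IsometryEquiv.neg hyperbolicForm)))) ↔
      ¬ φ.IsOrientationPreserving ∧ LinearMap.det (φ : ((Fin 2 → ℤ) × (Fin 2 → ℤ)) × (Fin 2 → ℤ) →ₗ[ℤ]
        ((Fin 2 → ℤ) × (Fin 2 → ℤ)) × (Fin 2 → ℤ)) = -1 := by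
  obtain ⟨hP, hd⟩ := isOrientationPreserving_and_det_trans_refl_prodCongr_threeU φ
    (hyperbolicSwap.trans (LinearMap.BilinForm.IsometryEquiv.neg hyperbolicForm))
  rw [isWordIn_commutators_iff_threeU, hP, hd, det_hyperbolicSwap_trans_neg]
  have hn := not_isOrientationPreserving_hyperbolicSwap_trans_neg
  constructor
  · rintro ⟨h₁, h₂⟩
    exact ⟨fun h ↦ hn (h₁.2 h), by linarith⟩
  · rintro ⟨h₁, h₂⟩
    exact ⟨iff_of_false hn h₁, by rw [h₂]; norm_num⟩

/-- **`O(3U)^{ab} ≅ (ℤ/2ℤ)²`: `O(3U) = ⨆ [O,O]·ρ` over `ρ ∈ {1, 1⊕1⊕σ_H, 1⊕1⊕(−1_H), 1⊕1⊕(−σ_H)}`** — every isometry of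
`(H ⊕ H) ⊕ H` lies in exactly one of the four cosets of `[O(3U), O(3U)] = SO⁺(3U)`, told apart by `(χ, det) ∈ {±1}²`
(the four membership criteria above are mutually exclusive). The `3U` case of "`O(L_{2d})^{ab} ≅ (ℤ/2ℤ)^{ρ(d)+2}`"
(`O(q_{3U})` trivial). [cite: GritsenkoHulekSankaran2009, Thm. 1.7, Cor. 1.8 and p. 4] -/
theorem isWordIn_commutators_or_or_or_threeU
    (φ : ((hyperbolicForm.prod hyperbolicForm).prod hyperbolicForm).IsometryEquiv
      ((hyperbolicForm.prod hyperbolicForm).prod hyperbolicForm)) :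
    IsWordIn {ψ | ∃ α β : ((hyperbolicForm.prod hyperbolicForm).prod hyperbolicForm).IsometryEquiv
        ((hyperbolicForm.prod hyperbolicForm).prod hyperbolicForm), ψ = ((β.symm.trans α.symm).trans β).trans α} φ ∨
    IsWordIn {ψ | ∃ α β : ((hyperbolicForm.prod hyperbolicForm).prod hyperbolicForm).IsometryEquiv
        ((hyperbolicForm.prod hyperbolicForm).prod hyperbolicForm), ψ = ((β.symm.trans α.symm).trans β).trans α}
      (φ.trans (LinearMap.BilinForm.IsometryEquiv.prodCongr
        (LinearMap.BilinForm.IsometryEquiv.refl (hyperbolicForm.prod hyperbolicForm)) hyperbolicSwap)) ∨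
    IsWordIn {ψ | ∃ α β : ((hyperbolicForm.prod hyperbolicForm).prod hyperbolicForm).IsometryEquiv
        ((hyperbolicForm.prod hyperbolicForm).prod hyperbolicForm), ψ = ((β.symm.trans α.symm).trans β).trans α}
      (φ.trans (LinearMap.BilinForm.IsometryEquiv.prodCongr
        (LinearMap.BilinForm.IsometryEquiv.refl (hyperbolicForm.prod hyperbolicForm))
        (LinearMap.BilinForm.IsometryEquiv.neg hyperbolicForm))) ∨
    IsWordIn {ψ | ∃ α β : ((hyperbolicForm.prod hyperbolicForm).prod hyperbolicForm).IsometryEquiv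
        ((hyperbolicForm.prod hyperbolicForm).prod hyperbolicForm), ψ = ((β.symm.trans α.symm).trans β).trans α}
      (φ.trans (LinearMap.BilinForm.IsometryEquiv.prodCongr
        (LinearMap.BilinForm.IsometryEquiv.refl (hyperbolicForm.prod hyperbolicForm))
        (hyperbolicSwap.trans (LinearMap.BilinForm.IsometryEquiv.neg hyperbolicForm)))) := by
  rw [isWordIn_commutators_iff_threeU, isWordIn_commutators_trans_swap_iff_threeU,
    isWordIn_commutators_trans_neg_iff_threeU, isWordIn_commutators_trans_swap_trans_neg_iff_threeU]
  rcases LinearMap.BilinForm.IsometryEquiv.det_eq_one_or_eq_neg_one φ with hd | hd <;>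
    by_cases hP : φ.IsOrientationPreserving
  · exact Or.inl ⟨hP, hd⟩
  · exact Or.inr (Or.inr (Or.inl ⟨hP, hd⟩))
  · exact Or.inr (Or.inl ⟨hP, hd⟩)
  · exact Or.inr (Or.inr (Or.inr ⟨hP, hd⟩))

end ThreeU

end Literature.Topology.FourManifolds

end
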